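import Summits.ABC.IUTFork.Repair.RHHullCellSlackFinReach
import Mathlib.Analysis.SpecialFunctions.Log.Basic
import HarnessLib

/-!
# R-H ROUND 3, AXIS D2 (D-0127/D-0130) — HEIGHT SCALING of the object class «WITHIN-PLACE FINANCING»: exponent `−1`, in kernel

PROOF-ONLY file (0 definitions, 0 `Prop` facts, no instance, no notation) of the abc-iut cell (D-0079 RESCUE sub-cell R-H, rung
LADDER-ABC:A2.RESCUE.H); seat abc-iut-rh2-q2-cond (gen 11), KEY `wake/KEY-abc-iut-rh2-q2-cond-D2-EXP-3.md` (21-frontier AXIS D 11:38:40Z /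
D-0130 11:44:07Z: «for each object type … derive its recovered-fraction exponent in h from the FINAL's (1)(d) law (credit conductor-type, T ∝ h)
with the bed as witness»). TAKES NO SIDE on [IUTchIII] Cor. 3.12 or on any author; nothing here asserts abc; every statement is integer (§1–§3, §5)
or elementary real (§4) arithmetic about OUR typed exact U2 cell `RH.DiffPricedHull.HullCellδ e m j δ r_in r_out`
(`:⟺ e·⌊(j²m − jδ − (j+1)r_in)/e⌋ ≤ m − (j+1)·r_out`), over abc-iut-rh2-w-2's `RHHullCellSlice` (`hullCellδ_iff_demand_le_price`, `gain_bounds`,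
`hullCellδ_one`, `not_hullCellδ_of_linear_lt`, `linear_of_hullCellδ`), abc-iut-rh-typ-3's `RHHullCellSlackSum` (`not_hullCellδ_iff_price_lt_demand`)
and this seat's `RHHullCellSlackFinReach` (p488873: `six_mul_sum_demand_eq_zero`, the worked place) — cited BY NAME, nothing restated, no file
of theirs edited.

THE CLASS (D-0121 FINAL 12:00Z `R/ROUND3/D0121-FINAL-1200Z.md` c9ab8e0bbc43dc94, items (1)(c) «the within-place gain is C_σ exactly», (5) rung
r2 − r1 «j₀ raised by WITHIN-PLACE financing from the place's own conjugate-fibre credit (tier EX/within)»). CURRENCY (spelled out in every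
statement, no `def`; MIN-SLICE §(i)/(i-w2).1, D0121-SPEC §1.0): at a bad place with `e = e_w > 0`, `m = m_q`, different exponent `δ`,
`G := r_in − r_out ≥ 0`, label `j ≥ 1`: DEMAND `d_j := (j²−1)·m`, PRICE `price_j := j·δ + (j+1)·G + ρ_j`, `ρ_j := (j²m − jδ − (j+1)r_in) mod e
∈ [0, e−1]`, SLACK `s_j := price_j − d_j`; slice `σ = {j : cell holds} = {1,…,j₀}` (`RHHullCellSlice.exists_sliceBoundary`); on-slice credit
`C_σ := Σ_{j ≤ j₀} s_j`; off-slice remainder `R := Σ_{j₀ < j ≤ l⋆} (d_j − price_j)`; the mass the class recovers at the place is `min(C_σ, R)`;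
the place mass is `M := Σ_{j ≤ l⋆} d_j = m·S(l⋆)`, `6·S(L) = L(L−1)(2L+5)` (`HullCellSlackFinReach.six_mul_sum_demand_eq_zero`). HEIGHT SCALING
(FINAL (1)(e), topt-lp-1 ADDENDUM v1.1 (X)): places FIXED (`e, δ, r_in, r_out, l⋆`), `m ↦ s·m`.

WHAT IS PROVED (namespace `Summit.ABC.IUTFork.Repair.RH.WithinPlaceFinancingHeightLaw`):
* §1 `slack_one_bracket` — THE CREDIT OF LABEL 1 IS CONDUCTOR-TYPE: `δ + 2G ≤ s_1 ≤ δ + 2G + (e−1)` for EVERY `m` (`d_1 = 0`; `s_1 = δ + 2G + ρ_1`,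
  `slack_one_eq`): no height on either side.
* §2 SLICE COLLAPSE `not_hullCellδ_of_height`: `0 ≤ δ`, `r_out ≤ r_in`, `2 ≤ j`, `2δ + 3G + (e−1) < 3m ⟹ ¬ HullCellδ e m j δ r_in r_out`; with
  `hullCellδ_one`: `hullCellδ_iff_eq_one_of_height` — above that height the slice is `{1}` exactly (`j₀ = 1`); and `sliceBoundary_sub_one_mul_le`:
  at EVERY height a holding label `J ≥ 1` has `(J−1)·m ≤ δ + G + (e−1)` (the FINAL's item (3) «j₀ law j₀(w) ≤ 1 + (δ_w+G_w+e_w)/m_q», there on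
  2,188/2,188 place rows; here a theorem at every local type): the slice shrinks like `1/m`.
* §3 FINANCING COLLAPSE `sum_slack_neg_of_height`: `3δ + 5G + 2(e−1) < 3m ⟹ Σ_{j ≤ L} s_j < 0` for every `L ≥ 2` — every cumulative slack beyond
  the slice is negative, i.e. FIN-REACH `J⋆ = 1`: the place's own credit finances NO further label (compare p488873's reach `⌊(3n−1)/2⌋` at
  licence label `n`: here `n = 1`).
* §4 THE LAW `financedMass_eq_slack_one` / `within_place_financing_height_law`: above that height `min(C_σ, R) = s_1 ∈ [δ + 2G, δ + 2G + (e−1)]`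
  — the recovered MASS is trapped between two `m`-FREE constants while `M = m·S(l⋆)` (`placeMass_pos`) — and its real form
  `recoveredFraction_bracket`: `(δ+2G)/M ≤ min(C_σ,R)/M ≤ (δ+2G+e−1)/M`. EXPONENT `−1` as a limit statement: `tendsto_log_div_log_of_bracket`
  (generic squeeze: `a/s ≤ f(s) ≤ b/s` eventually, `0 < a` ⟹ `log f(s)/log s → −1`) and its instance `recoveredFraction_log_slope` along
  `m = s·m₀`, `s → ∞`.
* §5 BED WITNESS (FREY `p = 7`, `l = 107`, the D-0121 worked place X1: `e = 1605`, `m_q = 210`, `δ = 1604`, `r_in = 268`, `r_out = −4472`,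
  `l⋆ = 53`; at `s = 1` p488873 §6 has `j₀ = 31`, `J⋆ = 46`, and `C_σ = 1,138,639`), by `decide` on the listed integers: thresholds
  `2δ+3G+(e−1) = 19032`, `3δ+5G+2(e−1) = 31720`; at `s = 32` (`m = 6720`) `j₀ = 1` but `s_1 + s_2 = 10120 ≥ 0 > s_1 + s_2 + s_3` (`J⋆ = 2`: the two
  collapses are distinct); at `s = 64` (`m = 13440`) `s_1 = 11149 ∈ [11084, 12688]` and `s_1 + s_2 = −10145 < 0` (`J⋆ = 1`), and the general law
  instantiated there (`row_frey7_l107_scale64_law`); exact onsets of this place (computed ≠ proved, seat table D2-EXP-3): `j₀ = 1` from `s = 30`,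
  `J⋆ = 1` from `s = 49`.
READING (docstrings only): with the place data fixed and `m_q ↦ s·m_q`, the within-place-financing class recovers the fraction
`f_w(s) = min(C_σ,R)/M ∈ [(δ+2G)/(S(l⋆)·m_q), (δ+2G+e−1)/(S(l⋆)·m_q)]·s⁻¹` for every `s` with `3·s·m_q > 3δ+5G+2(e−1)`: EXPONENT `−1` EXACTLY
(two-sided), CONSTANT bracket `m`-free and conductor-type (`δ = e_w·d_w`, `G` = log-shell radius gap), preserved by every datum-level pooling
(positive linear combination of places at the same `s`). Below the onset the gain is not a power law (`min` switches from `R`-limited to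
`C_σ`-limited; the continuum FIN-REACH reading `C_σ ≈ m·j₀³/6`, `j₀ ≈ (δ+G)/m` gives a transient `∝ s⁻³`); §2's `sliceBoundary_sub_one_mul_le`
bounds the slice at all heights. The datum-level numbers (onsets, constants in nats, three beds) are in the seat's table
D2-EXP-3-within-place-financing.tsv (computed ≠ proved).
HONEST FRAMING: integer identities/inequalities about OUR typed cell; nothing here asserts that abc is proved or refuted, that [IUTchIII]
Cor. 3.12 holds or fails at any datum, or takes a side on any author; typed ≠ proved; computed ≠ proved.
[cite: Mochizuki2012, IUTchIV Prop. 1.2 (i)(ii) p. 10, Prop. 1.4 p. 13; IUTchIII Cor. 3.12 p. 173–174] [claim: Mochizuki2012, status: disputed]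
-/

namespace Summit.ABC.IUTFork.Repair.RH.WithinPlaceFinancingHeightLaw

open Finset Filter Topology
open Summit.ABC.IUTFork.Repair.RH.DiffPricedHull Summit.ABC.IUTFork.Repair.RH.HullCellSlice
open Summit.ABC.IUTFork.Repair.RH.HullCellSlackSum Summit.ABC.IUTFork.Repair.RH.HullCellSlackLaw
open Summit.ABC.IUTFork.Repair.RH.HullCellSlackFinReach

/-! ## §1. The credit of label `1` is conductor-type -/

/-- **Label `1` carries NO demand and an `m`-FREE credit**: `s_1 = price_1 − d_1` satisfies `δ + 2G ≤ s_1 ≤ δ + 2G + (e − 1)` for EVERY `m`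
(`0 < e`; `d_1 = (1²−1)·m = 0`, `s_1 = δ + 2(r_in − r_out) + ρ_1`, `ρ_1 ∈ [0, e−1]` by `gain_bounds`). This is the FINAL's item (1)(d) law
«credit conductor-type» at the one label every slice keeps. [folklore] -/
theorem slack_one_bracket {e : ℤ} (he : 0 < e) (m δ rin rout : ℤ) :
    δ + 2 * (rin - rout) ≤
        ((1 : ℤ) * δ + (1 + 1) * (rin - rout) + ((1 : ℤ) ^ 2 * m - 1 * δ - (1 + 1) * rin) % e) - ((1 : ℤ) ^ 2 - 1) * m ∧
      ((1 : ℤ) * δ + (1 + 1) * (rin - rout) + ((1 : ℤ) ^ 2 * m - 1 * δ - (1 + 1) * rin) % e) - ((1 : ℤ) ^ 2 - 1) * m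
        ≤ δ + 2 * (rin - rout) + (e - 1) := by
  obtain ⟨h0, h1⟩ := gain_bounds he m 1 δ rin
  constructor <;> nlinarith [h0, h1]

/-- `s_1` in closed form: `s_1 = δ + 2(r_in − r_out) + (m − δ − 2r_in) mod e`. [folklore] -/
theorem slack_one_eq (e m δ rin rout : ℤ) :
    ((1 : ℤ) * δ + (1 + 1) * (rin - rout) + ((1 : ℤ) ^ 2 * m - 1 * δ - (1 + 1) * rin) % e) - ((1 : ℤ) ^ 2 - 1) * m
      = δ + 2 * (rin - rout) + (m - δ - 2 * rin) % e := by
  have : (1 : ℤ) ^ 2 * m - 1 * δ - (1 + 1) * rin = m - δ - 2 * rin := by ring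
  rw [this]; ring

/-! ## §2. Slice collapse: above `3m > 2δ + 3G + (e−1)` the slice is `{1}` -/

/-- **SLICE COLLAPSE**: `0 < e`, `0 ≤ δ`, `r_out ≤ r_in`, `2 ≤ j`, `2δ + 3(r_in − r_out) + (e−1) < 3m ⟹ ¬ HullCellδ e m j δ r_in r_out`.
(For `j ≥ 2`: `2(j²−1) ≥ 3j`, `j² − 1 ≥ j + 1`, `j² − 1 ≥ 3`, so `(j²−1)·3m > (j²−1)(2δ+3G+e−1) ≥ 3(jδ + (j+1)G + e − 1)`, and
`not_hullCellδ_of_linear_lt` applies.) Every label `≥ 2` is OFF: the demand `(j²−1)m` outgrows the linear price. [folklore] -/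
theorem not_hullCellδ_of_height {e m j δ rin rout : ℤ} (he : 0 < e) (hδ : 0 ≤ δ) (hio : rout ≤ rin) (hj : 2 ≤ j)
    (hm : 2 * δ + 3 * (rin - rout) + (e - 1) < 3 * m) : ¬ HullCellδ e m j δ rin rout := by
  apply not_hullCellδ_of_linear_lt he
  have hG : 0 ≤ rin - rout := by linarith
  have hm0 : 0 < m := by linarith
  have h1 : 0 ≤ (j - 2) * (2 * j + 1) := by nlinarith
  have h2 : 0 ≤ (j - 2) * (j + 1) := by nlinarith
  have h3 : 3 ≤ j ^ 2 - 1 := by nlinarith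
  nlinarith [mul_lt_mul_of_pos_left hm (by linarith : (0 : ℤ) < j ^ 2 - 1)]

/-- **Above the collapse height the slice is EXACTLY `{1}`**: for `1 ≤ j`, `HullCellδ e m j δ r_in r_out ⟺ j = 1` (`0 < e`, `e − 1 ≤ δ`,
`r_out ≤ r_in`, `2δ + 3G + (e−1) < 3m`; label `1` is IN by `hullCellδ_one`). So `j₀ = 1` and the on-slice credit is `C_σ = s_1`. [folklore] -/
theorem hullCellδ_iff_eq_one_of_height {e m j δ rin rout : ℤ} (he : 0 < e) (hδ : e - 1 ≤ δ) (hio : rout ≤ rin) (hj : 1 ≤ j)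
    (hm : 2 * δ + 3 * (rin - rout) + (e - 1) < 3 * m) : HullCellδ e m j δ rin rout ↔ j = 1 := by
  constructor
  · intro h
    by_contra hne
    exact not_hullCellδ_of_height he (by linarith) hio (by omega) hm h
  · rintro rfl
    exact hullCellδ_one he hδ hio

/-- **THE SLICE SHRINKS LIKE `1/m` (the FINAL's item (3) «j₀ law», here at every local type)**: if the cell holds at a label `J ≥ 1` then
`(J − 1)·m ≤ δ + (r_in − r_out) + (e − 1)` (`0 < e`, `0 ≤ δ`, `r_out ≤ r_in`). From `linear_of_hullCellδ`: `(J²−1)m ≤ Jδ + (J+1)G + (e−1)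
≤ (J+1)(δ + G + e − 1)`, cancel `J + 1 > 0`. Hence `j₀ ≤ 1 + (δ+G+e−1)/m`: with the place fixed and `m ↦ s·m` the slice boundary is `1` as soon
as `s·m > δ + G + e − 1`. [folklore] -/
theorem sliceBoundary_sub_one_mul_le {e m J δ rin rout : ℤ} (he : 0 < e) (hδ : 0 ≤ δ) (hio : rout ≤ rin) (hJ : 1 ≤ J)
    (h : HullCellδ e m J δ rin rout) : (J - 1) * m ≤ δ + (rin - rout) + (e - 1) := by
  have hlin := linear_of_hullCellδ he h
  have hG : 0 ≤ rin - rout := by linarith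
  have h1 : (J + 1) * ((J - 1) * m) ≤ (J + 1) * (δ + (rin - rout) + (e - 1)) := by nlinarith
  exact le_of_mul_le_mul_left h1 (by linarith)

/-! ## §3. Financing collapse: above `3m > 3δ + 5G + 2(e−1)` the place's own credit finances no further label -/

/-- Above the slice-collapse height every label `j ≥ 2` has NEGATIVE slack `s_j = price_j − d_j < 0` (`0 < e`, `0 ≤ δ`, `r_out ≤ r_in`,
`2δ + 3G + (e−1) < 3m`) — `not_hullCellδ_of_height` in ledger form (`not_hullCellδ_iff_price_lt_demand`). [folklore] -/
theorem slack_neg_of_height {e m j δ rin rout : ℤ} (he : 0 < e) (hδ : 0 ≤ δ) (hio : rout ≤ rin) (hj : 2 ≤ j)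
    (hm : 2 * δ + 3 * (rin - rout) + (e - 1) < 3 * m) :
    (j * δ + (j + 1) * (rin - rout) + (j ^ 2 * m - j * δ - (j + 1) * rin) % e) - (j ^ 2 - 1) * m < 0 := by
  have h := (not_hullCellδ_iff_price_lt_demand e m j δ rin rout).1 (not_hullCellδ_of_height he hδ hio hj hm)
  linarith

/-- **The credit of label `1` does not cover the deficit of label `2`**: `3δ + 5(r_in − r_out) + 2(e−1) < 3m ⟹ s_1 + s_2 < 0` (`0 < e`;
`s_1 ≤ δ + 2G + (e−1)`, `s_2 = 2δ + 3G + ρ_2 − 3m ≤ 2δ + 3G + (e−1) − 3m`). [folklore] -/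
theorem slack_one_add_slack_two_neg {e m δ rin rout : ℤ} (he : 0 < e)
    (hm : 3 * δ + 5 * (rin - rout) + 2 * (e - 1) < 3 * m) :
    (((1 : ℤ) * δ + (1 + 1) * (rin - rout) + ((1 : ℤ) ^ 2 * m - 1 * δ - (1 + 1) * rin) % e) - ((1 : ℤ) ^ 2 - 1) * m) +
      (((2 : ℤ) * δ + (2 + 1) * (rin - rout) + ((2 : ℤ) ^ 2 * m - 2 * δ - (2 + 1) * rin) % e) - ((2 : ℤ) ^ 2 - 1) * m) < 0 := by
  have h1 := (slack_one_bracket he m δ rin rout).2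
  have h2 := (gain_bounds he m 2 δ rin).2
  nlinarith [h1, h2]

/-- **FINANCING COLLAPSE (FIN-REACH `J⋆ = 1`)**: `0 < e`, `0 ≤ δ`, `r_out ≤ r_in`, `3δ + 5G + 2(e−1) < 3m ⟹ Σ_{j=1}^{L} s_j < 0` for every
`L ≥ 2` (labels written `j = 1 + k`, `k < L`, as in `RHHullCellSlackFinReach`). Every cumulative slack beyond the slice is negative, so the
indicator weight `𝟙{j ≤ L}` meets the weighted door's aggregate hypothesis at this place for NO `L ≥ 2`: within-place financing recovers no whole
label; what it recovers is the partial cover `s_1` of label `2`'s deficit (§4). (Induction on `L`: base `slack_one_add_slack_two_neg`, step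
`slack_neg_of_height` since `3δ + 5G + 2(e−1) ≥ 2δ + 3G + (e−1)`.) [folklore] -/
theorem sum_slack_neg_of_height {e m δ rin rout : ℤ} (he : 0 < e) (hδ : 0 ≤ δ) (hio : rout ≤ rin)
    (hm : 3 * δ + 5 * (rin - rout) + 2 * (e - 1) < 3 * m) {L : ℕ} (hL : 2 ≤ L) :
    ∑ k ∈ range L, (((1 + (k : ℤ)) * δ + (1 + (k : ℤ) + 1) * (rin - rout) +
        ((1 + (k : ℤ)) ^ 2 * m - (1 + (k : ℤ)) * δ - (1 + (k : ℤ) + 1) * rin) % e) - ((1 + (k : ℤ)) ^ 2 - 1) * m) < 0 := by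
  induction L, hL using Nat.le_induction with
  | base =>
    have h := slack_one_add_slack_two_neg (m := m) (δ := δ) (rin := rin) (rout := rout) he hm
    have hx : ∑ k ∈ range 2, (((1 + (k : ℤ)) * δ + (1 + (k : ℤ) + 1) * (rin - rout) +
        ((1 + (k : ℤ)) ^ 2 * m - (1 + (k : ℤ)) * δ - (1 + (k : ℤ) + 1) * rin) % e) - ((1 + (k : ℤ)) ^ 2 - 1) * m) =
        (((1 : ℤ) * δ + (1 + 1) * (rin - rout) + ((1 : ℤ) ^ 2 * m - 1 * δ - (1 + 1) * rin) % e) - ((1 : ℤ) ^ 2 - 1) * m) +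
        (((2 : ℤ) * δ + (2 + 1) * (rin - rout) + ((2 : ℤ) ^ 2 * m - 2 * δ - (2 + 1) * rin) % e) - ((2 : ℤ) ^ 2 - 1) * m) := by
      rw [sum_range_succ, sum_range_one]
      norm_num
    rw [hx]; exact h
  | succ L hL ih =>
    rw [sum_range_succ]
    have hG : 0 ≤ rin - rout := by linarith
    have hm' : 2 * δ + 3 * (rin - rout) + (e - 1) < 3 * m := by linarith
    have hL2 : (2 : ℤ) ≤ (L : ℤ) := by exact_mod_cast hL
    have hj : (2 : ℤ) ≤ 1 + (L : ℤ) := by linarith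
    have hs := slack_neg_of_height (j := 1 + (L : ℤ)) he hδ hio hj hm'
    linarith [ih, hs]

/-! ## §4. The law: recovered mass trapped between two `m`-free constants; exponent `−1` -/

/-- **THE RECOVERED MASS IS `s_1`**: above the financing-collapse height (`0 < e`, `0 ≤ δ`, `r_out ≤ r_in`, `3δ + 5G + 2(e−1) < 3m`, `2 ≤ L`),
with `j₀ = 1` (§2) the on-slice credit is `C_σ = s_1` and the off-slice remainder is `R = Σ_{j=2}^{L} (d_j − price_j) = s_1 − Σ_{j ≤ L} s_j > s_1`
(§3), so `min(C_σ, R) = s_1`: «the within-place gain is C_σ exactly» (FINAL (1)(c)) in its high-height form. [folklore] -/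
theorem financedMass_eq_slack_one {e m δ rin rout : ℤ} (he : 0 < e) (hδ : 0 ≤ δ) (hio : rout ≤ rin)
    (hm : 3 * δ + 5 * (rin - rout) + 2 * (e - 1) < 3 * m) {L : ℕ} (hL : 2 ≤ L) :
    min ((((1 : ℤ) * δ + (1 + 1) * (rin - rout) + ((1 : ℤ) ^ 2 * m - 1 * δ - (1 + 1) * rin) % e) - ((1 : ℤ) ^ 2 - 1) * m))
        ((((1 : ℤ) * δ + (1 + 1) * (rin - rout) + ((1 : ℤ) ^ 2 * m - 1 * δ - (1 + 1) * rin) % e) - ((1 : ℤ) ^ 2 - 1) * m) -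
          ∑ k ∈ range L, (((1 + (k : ℤ)) * δ + (1 + (k : ℤ) + 1) * (rin - rout) +
            ((1 + (k : ℤ)) ^ 2 * m - (1 + (k : ℤ)) * δ - (1 + (k : ℤ) + 1) * rin) % e) - ((1 + (k : ℤ)) ^ 2 - 1) * m))
      = (((1 : ℤ) * δ + (1 + 1) * (rin - rout) + ((1 : ℤ) ^ 2 * m - 1 * δ - (1 + 1) * rin) % e) - ((1 : ℤ) ^ 2 - 1) * m) := by
  have h := sum_slack_neg_of_height he hδ hio hm hL
  apply min_eq_left
  linarith

/-- **WITHIN-PLACE FINANCING HEIGHT LAW (integer form).** `0 < e`, `0 ≤ δ`, `r_out ≤ r_in`, `3δ + 5(r_in − r_out) + 2(e−1) < 3m`, `2 ≤ L`: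
the mass the class recovers at the place, `min(C_σ, R)`, satisfies `δ + 2G ≤ min(C_σ, R) ≤ δ + 2G + (e − 1)` — two `m`-FREE constants —
while the place mass is `m·S(L)` (`six_mul_sum_demand_eq_zero`). With the place fixed and `m ↦ s·m` this holds for every
`s > (3δ + 5G + 2(e−1))/(3m)`: recovered fraction `= Θ(s⁻¹)` with the constant bracket `[(δ+2G), (δ+2G+e−1)]/(m·S(L))`. [folklore] -/
theorem within_place_financing_height_law {e m δ rin rout : ℤ} (he : 0 < e) (hδ : 0 ≤ δ) (hio : rout ≤ rin)
    (hm : 3 * δ + 5 * (rin - rout) + 2 * (e - 1) < 3 * m) {L : ℕ} (hL : 2 ≤ L) :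
    δ + 2 * (rin - rout) ≤
        min ((((1 : ℤ) * δ + (1 + 1) * (rin - rout) + ((1 : ℤ) ^ 2 * m - 1 * δ - (1 + 1) * rin) % e) - ((1 : ℤ) ^ 2 - 1) * m))
          ((((1 : ℤ) * δ + (1 + 1) * (rin - rout) + ((1 : ℤ) ^ 2 * m - 1 * δ - (1 + 1) * rin) % e) - ((1 : ℤ) ^ 2 - 1) * m) -
            ∑ k ∈ range L, (((1 + (k : ℤ)) * δ + (1 + (k : ℤ) + 1) * (rin - rout) +
              ((1 + (k : ℤ)) ^ 2 * m - (1 + (k : ℤ)) * δ - (1 + (k : ℤ) + 1) * rin) % e) - ((1 + (k : ℤ)) ^ 2 - 1) * m)) ∧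
      min ((((1 : ℤ) * δ + (1 + 1) * (rin - rout) + ((1 : ℤ) ^ 2 * m - 1 * δ - (1 + 1) * rin) % e) - ((1 : ℤ) ^ 2 - 1) * m))
          ((((1 : ℤ) * δ + (1 + 1) * (rin - rout) + ((1 : ℤ) ^ 2 * m - 1 * δ - (1 + 1) * rin) % e) - ((1 : ℤ) ^ 2 - 1) * m) -
            ∑ k ∈ range L, (((1 + (k : ℤ)) * δ + (1 + (k : ℤ) + 1) * (rin - rout) +
              ((1 + (k : ℤ)) ^ 2 * m - (1 + (k : ℤ)) * δ - (1 + (k : ℤ) + 1) * rin) % e) - ((1 + (k : ℤ)) ^ 2 - 1) * m))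
        ≤ δ + 2 * (rin - rout) + (e - 1) := by
  rw [financedMass_eq_slack_one he hδ hio hm hL]
  exact slack_one_bracket he m δ rin rout

/-- **The place mass is `m·S(L)` and it is POSITIVE** for `0 < m`, `2 ≤ L`: `0 < Σ_{j ≤ L} d_j` (`6·Σ d_j = m·L(L−1)(2L+5)` by
`six_mul_sum_demand_eq_zero`). [folklore] -/
theorem placeMass_pos {m : ℤ} (hm : 0 < m) {L : ℕ} (hL : 2 ≤ L) :
    0 < ∑ k ∈ range L, ((1 + (k : ℤ)) ^ 2 - 1) * m := by
  have h := six_mul_sum_demand_eq_zero m L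
  have hL' : (2 : ℤ) ≤ (L : ℤ) := by exact_mod_cast hL
  have h1 : 0 < m * ((L : ℤ) * (L - 1) * (2 * L + 5)) := by
    apply mul_pos hm
    have : 0 < (L : ℤ) * (L - 1) := by nlinarith
    nlinarith
  linarith

/-- **WITHIN-PLACE FINANCING HEIGHT LAW (fraction form).** Under the hypotheses of `within_place_financing_height_law` and `0 < m`:
`(δ + 2G)/M ≤ min(C_σ, R)/M ≤ (δ + 2G + e − 1)/M` with the place mass `M = Σ_{j ≤ L} d_j = m·S(L) > 0` — the recovered FRACTION is
`Θ(1/m)` with an `m`-free conductor-type numerator. [folklore] -/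
theorem recoveredFraction_bracket {e m δ rin rout : ℤ} (he : 0 < e) (hδ : 0 ≤ δ) (hio : rout ≤ rin) (hm0 : 0 < m)
    (hm : 3 * δ + 5 * (rin - rout) + 2 * (e - 1) < 3 * m) {L : ℕ} (hL : 2 ≤ L) :
    ((δ + 2 * (rin - rout) : ℤ) : ℝ) / ((∑ k ∈ range L, ((1 + (k : ℤ)) ^ 2 - 1) * m : ℤ) : ℝ) ≤
        ((min ((((1 : ℤ) * δ + (1 + 1) * (rin - rout) + ((1 : ℤ) ^ 2 * m - 1 * δ - (1 + 1) * rin) % e) - ((1 : ℤ) ^ 2 - 1) * m))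
          ((((1 : ℤ) * δ + (1 + 1) * (rin - rout) + ((1 : ℤ) ^ 2 * m - 1 * δ - (1 + 1) * rin) % e) - ((1 : ℤ) ^ 2 - 1) * m) -
            ∑ k ∈ range L, (((1 + (k : ℤ)) * δ + (1 + (k : ℤ) + 1) * (rin - rout) +
              ((1 + (k : ℤ)) ^ 2 * m - (1 + (k : ℤ)) * δ - (1 + (k : ℤ) + 1) * rin) % e) - ((1 + (k : ℤ)) ^ 2 - 1) * m)) : ℤ) : ℝ) /
          ((∑ k ∈ range L, ((1 + (k : ℤ)) ^ 2 - 1) * m : ℤ) : ℝ) ∧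
      ((min ((((1 : ℤ) * δ + (1 + 1) * (rin - rout) + ((1 : ℤ) ^ 2 * m - 1 * δ - (1 + 1) * rin) % e) - ((1 : ℤ) ^ 2 - 1) * m))
          ((((1 : ℤ) * δ + (1 + 1) * (rin - rout) + ((1 : ℤ) ^ 2 * m - 1 * δ - (1 + 1) * rin) % e) - ((1 : ℤ) ^ 2 - 1) * m) -
            ∑ k ∈ range L, (((1 + (k : ℤ)) * δ + (1 + (k : ℤ) + 1) * (rin - rout) +
              ((1 + (k : ℤ)) ^ 2 * m - (1 + (k : ℤ)) * δ - (1 + (k : ℤ) + 1) * rin) % e) - ((1 + (k : ℤ)) ^ 2 - 1) * m)) : ℤ) : ℝ) /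
          ((∑ k ∈ range L, ((1 + (k : ℤ)) ^ 2 - 1) * m : ℤ) : ℝ) ≤
        ((δ + 2 * (rin - rout) + (e - 1) : ℤ) : ℝ) / ((∑ k ∈ range L, ((1 + (k : ℤ)) ^ 2 - 1) * m : ℤ) : ℝ) := by
  obtain ⟨h1, h2⟩ := within_place_financing_height_law he hδ hio hm hL
  have hM : (0 : ℝ) < ((∑ k ∈ range L, ((1 + (k : ℤ)) ^ 2 - 1) * m : ℤ) : ℝ) := by exact_mod_cast placeMass_pos hm0 hL
  constructor
  · exact div_le_div_of_nonneg_right (by exact_mod_cast h1) hM.le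
  · exact div_le_div_of_nonneg_right (by exact_mod_cast h2) hM.le

/-- **EXPONENT `−1` (generic squeeze).** If `a/s ≤ f(s) ≤ b/s` for all large `s : ℕ` with `0 < a ≤ b`, then `log f(s) / log s → −1`.
(`log a − log s ≤ log f(s) ≤ log b − log s`, divide by `log s → +∞`.) The typed meaning of «recovered-fraction exponent in h equals −1» for a
quantity obeying a two-sided `Θ(1/s)` bracket. [folklore] -/
theorem tendsto_log_div_log_of_bracket {f : ℕ → ℝ} {a b : ℝ} (ha : 0 < a) (hab : a ≤ b)
    (hf : ∀ᶠ s : ℕ in atTop, a / (s : ℝ) ≤ f s ∧ f s ≤ b / (s : ℝ)) :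
    Tendsto (fun s : ℕ => Real.log (f s) / Real.log (s : ℝ)) atTop (𝓝 (-1)) := by
  have hb : 0 < b := lt_of_lt_of_le ha hab
  have hlog : Tendsto (fun s : ℕ => Real.log (s : ℝ)) atTop atTop :=
    Real.tendsto_log_atTop.comp tendsto_natCast_atTop_atTop
  have hlo : Tendsto (fun s : ℕ => Real.log a / Real.log (s : ℝ) - 1) atTop (𝓝 (-1)) := by
    have h0 : Tendsto (fun s : ℕ => Real.log a / Real.log (s : ℝ)) atTop (𝓝 0) := hlog.const_div_atTop (Real.log a)
    have := h0.sub_const 1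
    simpa using this
  have hhi : Tendsto (fun s : ℕ => Real.log b / Real.log (s : ℝ) - 1) atTop (𝓝 (-1)) := by
    have h0 : Tendsto (fun s : ℕ => Real.log b / Real.log (s : ℝ)) atTop (𝓝 0) := hlog.const_div_atTop (Real.log b)
    have := h0.sub_const 1
    simpa using this
  have hs1 : ∀ᶠ s : ℕ in atTop, (1 : ℝ) < (s : ℝ) := by
    filter_upwards [eventually_gt_atTop 1] with s hs
    exact_mod_cast hs
  refine tendsto_of_tendsto_of_tendsto_of_le_of_le' hlo hhi ?_ ?_
  · filter_upwards [hf, hs1] with s hfs hs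
    have hspos : (0 : ℝ) < (s : ℝ) := by linarith
    have hlogs : 0 < Real.log (s : ℝ) := Real.log_pos hs
    have h1 : Real.log (a / (s : ℝ)) ≤ Real.log (f s) := Real.log_le_log (div_pos ha hspos) hfs.1
    rw [Real.log_div ha.ne' hspos.ne'] at h1
    rw [div_sub_one hlogs.ne', div_le_div_iff_of_pos_right hlogs]
    linarith
  · filter_upwards [hf, hs1] with s hfs hs
    have hspos : (0 : ℝ) < (s : ℝ) := by linarith
    have hlogs : 0 < Real.log (s : ℝ) := Real.log_pos hs
    have hfpos : 0 < f s := lt_of_lt_of_le (div_pos ha hspos) hfs.1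
    have h2 : Real.log (f s) ≤ Real.log (b / (s : ℝ)) := Real.log_le_log hfpos hfs.2
    rw [Real.log_div hb.ne' hspos.ne'] at h2
    rw [div_sub_one hlogs.ne', div_le_div_iff_of_pos_right hlogs]
    linarith

/-- **EXPONENT `−1` for the class, along the height scaling `m = s·m₀` (`s → ∞`).** Place data fixed (`0 < e`, `0 ≤ δ`, `r_out ≤ r_in`,
`0 < m₀`, `2 ≤ L`); `f(s) := min(C_σ, R)/M` at `m = s·m₀` (spelled out; above the onset `C_σ = s_1`, §2–§4). Then `log f(s)/log s → −1`.
The bracket of `recoveredFraction_bracket` holds for every `s` with `3δ + 5G + 2(e−1) < 3·s·m₀` (eventually, Archimedes), with the constants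
`(δ+2G)/M(1) ≤ (δ+2G+e−1)/M(1)`; the hypothesis `0 < δ + 2(r_in − r_out)` excludes the corner `δ = 0 = G` (there `s_1` may vanish and nothing
is ever recovered); at a ramified place `δ ≥ e − 1 ≥ 1`. [folklore] -/
theorem recoveredFraction_log_slope {e m₀ δ rin rout : ℤ} (he : 0 < e) (hδ : 0 ≤ δ) (hio : rout ≤ rin) (hm0 : 0 < m₀)
    (hpos : 0 < δ + 2 * (rin - rout)) {L : ℕ} (hL : 2 ≤ L) :
    Tendsto (fun s : ℕ =>
      Real.log (((min ((((1 : ℤ) * δ + (1 + 1) * (rin - rout) + ((1 : ℤ) ^ 2 * ((s : ℤ) * m₀) - 1 * δ - (1 + 1) * rin) % e) -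
              ((1 : ℤ) ^ 2 - 1) * ((s : ℤ) * m₀)))
          ((((1 : ℤ) * δ + (1 + 1) * (rin - rout) + ((1 : ℤ) ^ 2 * ((s : ℤ) * m₀) - 1 * δ - (1 + 1) * rin) % e) -
              ((1 : ℤ) ^ 2 - 1) * ((s : ℤ) * m₀)) -
            ∑ k ∈ range L, (((1 + (k : ℤ)) * δ + (1 + (k : ℤ) + 1) * (rin - rout) +
              ((1 + (k : ℤ)) ^ 2 * ((s : ℤ) * m₀) - (1 + (k : ℤ)) * δ - (1 + (k : ℤ) + 1) * rin) % e) -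
                ((1 + (k : ℤ)) ^ 2 - 1) * ((s : ℤ) * m₀))) : ℤ) : ℝ) /
          ((∑ k ∈ range L, ((1 + (k : ℤ)) ^ 2 - 1) * ((s : ℤ) * m₀) : ℤ) : ℝ)) / Real.log (s : ℝ)) atTop (𝓝 (-1)) := by
  have hS : (0 : ℝ) < ((∑ k ∈ range L, ((1 + (k : ℤ)) ^ 2 - 1) * m₀ : ℤ) : ℝ) := by exact_mod_cast placeMass_pos hm0 hL
  set S : ℝ := ((∑ k ∈ range L, ((1 + (k : ℤ)) ^ 2 - 1) * m₀ : ℤ) : ℝ) with hSdef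
  have ha : (0 : ℝ) < ((δ + 2 * (rin - rout) : ℤ) : ℝ) / S := div_pos (by exact_mod_cast hpos) hS
  have hab : ((δ + 2 * (rin - rout) : ℤ) : ℝ) / S ≤ ((δ + 2 * (rin - rout) + (e - 1) : ℤ) : ℝ) / S := by
    apply div_le_div_of_nonneg_right _ hS.le
    have : δ + 2 * (rin - rout) ≤ δ + 2 * (rin - rout) + (e - 1) := by linarith
    exact_mod_cast this
  apply tendsto_log_div_log_of_bracket ha hab
  have hev : ∀ᶠ s : ℕ in atTop, 3 * δ + 5 * (rin - rout) + 2 * (e - 1) < 3 * ((s : ℤ) * m₀) := by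
    obtain ⟨N, hN⟩ := Archimedean.arch (3 * δ + 5 * (rin - rout) + 2 * (e - 1) + 1) hm0
    filter_upwards [eventually_ge_atTop N] with s hs
    have hs' : (N : ℤ) ≤ (s : ℤ) := by exact_mod_cast hs
    have h1 : 3 * δ + 5 * (rin - rout) + 2 * (e - 1) + 1 ≤ (N : ℤ) * m₀ := by simpa [nsmul_eq_mul] using hN
    nlinarith
  filter_upwards [hev, eventually_gt_atTop 0] with s hs hs0
  have hsm : 0 < (s : ℤ) * m₀ := mul_pos (by exact_mod_cast hs0) hm0
  obtain ⟨h1, h2⟩ := recoveredFraction_bracket (m := (s : ℤ) * m₀) he hδ hio hsm hs hL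
  have hM : ((∑ k ∈ range L, ((1 + (k : ℤ)) ^ 2 - 1) * ((s : ℤ) * m₀) : ℤ) : ℝ) = (s : ℝ) * S := by
    rw [hSdef]; push_cast
    rw [mul_sum]
    exact sum_congr rfl fun k _ => by ring
  constructor
  · rw [div_div, mul_comm S, ← hM]; exact h1
  · rw [div_div, mul_comm S, ← hM]; exact h2

/-! ## §5. Bed witness: the D-0121 worked place X1 (FREY `p = 7`, `l = 107`) under height scaling -/

/-- The two thresholds of the worked place (`e = 1605`, `δ = 1604`, `r_in = 268`, `r_out = −4472`, so `G = 4740`):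
`2δ + 3G + (e−1) = 19032` (slice collapse for `3m > 19032`, i.e. `m ≥ 6345`, scale `s ≥ 31` of `m_q = 210`) and
`3δ + 5G + 2(e−1) = 31720` (financing collapse for `m ≥ 10574`, `s ≥ 51`); the credit bracket is `[δ+2G, δ+2G+e−1] = [11084, 12688]`. [folklore] -/
theorem row_frey7_l107_thresholds :
    2 * (1604 : ℤ) + 3 * (268 - (-4472)) + (1605 - 1) = 19032 ∧ 3 * (1604 : ℤ) + 5 * (268 - (-4472)) + 2 * (1605 - 1) = 31720 ∧
      (1604 : ℤ) + 2 * (268 - (-4472)) = 11084 ∧ (1604 : ℤ) + 2 * (268 - (-4472)) + (1605 - 1) = 12688 := by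
  norm_num

/-- **Scale `s = 32` (`m = 6720`): the slice has collapsed (`j₀ = 1`: cell IN at `1`, OFF at `2`) but financing still reaches label `2`**
(`s_1 = 12454`, `s_2 = −2334`, `s_1 + s_2 = 10120 ≥ 0`, `s_3 = −29962`, `s_1 + s_2 + s_3 < 0`: `J⋆ = 2`) — the two collapses of §2/§3 are
distinct events; at `s = 1` this place has `j₀ = 31`, `J⋆ = 46` (`HullCellSlackFinReach.row_frey7_l107_boundary` / `_exact_reach`). [folklore] -/
theorem row_frey7_l107_scale32 :
    HullCellδ 1605 6720 1 1604 268 (-4472) ∧ ¬ HullCellδ 1605 6720 2 1604 268 (-4472) ∧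
      (6720 : ℤ) - (1605 * ((1 ^ 2 * 6720 - 1 * 1604 - (1 + 1) * 268) / 1605) + (1 + 1) * (-4472)) = 12454 ∧
      (6720 : ℤ) - (1605 * ((2 ^ 2 * 6720 - 2 * 1604 - (2 + 1) * 268) / 1605) + (2 + 1) * (-4472)) = -2334 ∧
      (6720 : ℤ) - (1605 * ((3 ^ 2 * 6720 - 3 * 1604 - (3 + 1) * 268) / 1605) + (3 + 1) * (-4472)) = -29962 := by
  unfold HullCellδ
  decide

/-- **Scale `s = 64` (`m = 13440`): both collapses have happened** — `s_1 = 11149 ∈ [11084, 12688]` (the `m`-free bracket of §1; at `s = 32`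
it was `12454`, at `s = 1` `12364`: the credit oscillates inside the bracket with `ρ_1 = (m − δ − 2r_in) mod e`, it does not grow), `s_2 = −21294`,
so `s_1 + s_2 = −10145 < 0` (`J⋆ = 1`), while the place mass `m·S(53) = 13440·50986` has grown `64`-fold since the bed: recovered fraction
`11149/(13440·50986) ≈ 1.6·10⁻⁵` — the `s⁻¹` law with constant in `[11084, 12688]/(210·50986·s)`. [folklore] -/
theorem row_frey7_l107_scale64 :
    (13440 : ℤ) - (1605 * ((1 ^ 2 * 13440 - 1 * 1604 - (1 + 1) * 268) / 1605) + (1 + 1) * (-4472)) = 11149 ∧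
      (11084 : ℤ) ≤ 11149 ∧ (11149 : ℤ) ≤ 12688 ∧
      (13440 : ℤ) - (1605 * ((2 ^ 2 * 13440 - 2 * 1604 - (2 + 1) * 268) / 1605) + (2 + 1) * (-4472)) = -21294 ∧
      3 * (1604 : ℤ) + 5 * (268 - (-4472)) + 2 * (1605 - 1) < 3 * 13440 ∧ (6 : ℤ) * 50986 = 53 * (53 - 1) * (2 * 53 + 5) := by
  decide

/-- The general law instantiated at the worked place, scale `64` (`m = 13440 = 64·210`, `L = l⋆ = 53`): the recovered mass `min(C_σ, R)` lies in
`[δ + 2G, δ + 2G + e − 1] = [11084, 12688]` — obtained from `within_place_financing_height_law`, not by evaluation. [folklore] -/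
theorem row_frey7_l107_scale64_law :
    (1604 : ℤ) + 2 * (268 - (-4472)) ≤
        min ((((1 : ℤ) * 1604 + (1 + 1) * (268 - (-4472)) + ((1 : ℤ) ^ 2 * 13440 - 1 * 1604 - (1 + 1) * 268) % 1605) -
            ((1 : ℤ) ^ 2 - 1) * 13440))
          ((((1 : ℤ) * 1604 + (1 + 1) * (268 - (-4472)) + ((1 : ℤ) ^ 2 * 13440 - 1 * 1604 - (1 + 1) * 268) % 1605) -
            ((1 : ℤ) ^ 2 - 1) * 13440) -
            ∑ k ∈ range 53, (((1 + (k : ℤ)) * 1604 + (1 + (k : ℤ) + 1) * (268 - (-4472)) +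
              ((1 + (k : ℤ)) ^ 2 * 13440 - (1 + (k : ℤ)) * 1604 - (1 + (k : ℤ) + 1) * 268) % 1605) - ((1 + (k : ℤ)) ^ 2 - 1) * 13440)) ∧
      min ((((1 : ℤ) * 1604 + (1 + 1) * (268 - (-4472)) + ((1 : ℤ) ^ 2 * 13440 - 1 * 1604 - (1 + 1) * 268) % 1605) -
            ((1 : ℤ) ^ 2 - 1) * 13440))
          ((((1 : ℤ) * 1604 + (1 + 1) * (268 - (-4472)) + ((1 : ℤ) ^ 2 * 13440 - 1 * 1604 - (1 + 1) * 268) % 1605) -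
            ((1 : ℤ) ^ 2 - 1) * 13440) -
            ∑ k ∈ range 53, (((1 + (k : ℤ)) * 1604 + (1 + (k : ℤ) + 1) * (268 - (-4472)) +
              ((1 + (k : ℤ)) ^ 2 * 13440 - (1 + (k : ℤ)) * 1604 - (1 + (k : ℤ) + 1) * 268) % 1605) - ((1 + (k : ℤ)) ^ 2 - 1) * 13440))
        ≤ (1604 : ℤ) + 2 * (268 - (-4472)) + (1605 - 1) :=
  within_place_financing_height_law (L := 53) (by norm_num) (by norm_num) (by norm_num) (by norm_num) (by norm_num)

end Summit.ABC.IUTFork.Repair.RH.WithinPlaceFinancingHeightLaw
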